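import Literature.NumberTheory.EllipticCurves.RibetGoodLatticeExistsProofs
import Literature.NumberTheory.EllipticCurves.Rank1Residual.Predicates
import Literature.NumberTheory.GaloisRepresentations.AbsGaloisOuterConj
import Literature.NumberTheory.GaloisRepresentations.IntegralGaloisActionProofs
import Literature.NumberTheory.EllipticCurves.SemistableModPImageAbelianProofs
import Literature.NumberTheory.EllipticCurves.HeegnerPointsKolyvaginConjugation
import Literature.NumberTheory.EllipticCurves.Rank1Residual.GVParityTwistProofs
import Literature.NumberTheory.EllipticCurves.KellerYin2024.ResidualPairUniqueness
import Summits.BirchSwinnertonDyer.Rank1Residual.X1.KellerYinGoodLattice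
import Summits.BirchSwinnertonDyer.BirchSwinnertonDyer.Theorems.EisensteinPrimesBSDpOnCellCImprimitiveCountSplitOfBrHlat
import HarnessLib

/-!
# The good lattice at an odd good ordinary prime has a UNIQUE stable line (over `ℚ`, over an index-two
# subgroup containing inertia, over an imaginary quadratic `K` with `p` split), hence a UNIQUE residual
# pair `(θsub, θquot)` over `K` — crux 2 `GoodLatticeBDPValue`, θ-axis of the content stub

Cell `bsd-eis`, width seat `bsd-line-x1-p1-w2` gen 15, crux 2 (stmt-BirchSwinnertonDyer-19032), line
`halves` v33N; helper `--supports`, closes no stub. PROVED, no named fact, no `sorry`: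
§1 `sup_eq_top_of_ne` (and Cell C's `SplitMultWallHlat.smul_eq_of_ne_line`, imported: an element with
`(σ − 1)E[p] ⊆ L` fixes every `σ`-stable line `Ψ ≠ L` pointwise). §2 at an odd GOOD ORDINARY prime the tree's REDUCTION LINE `L` at
`𝔓₀ ∣ p` (`RibetGoodLattice.…exists_reductionLine_adicCompletionPrime`: `(σ − 1)E[p] ⊆ L` on `I_{𝔓₀}`,
a mover `σ₀ ∈ I_{𝔓₀}`; Greenberg–Vatsal p. 26) makes every rational line `≠ L` unramified at `p`, so the
normalisation (hlat) «every rational `p`-line ramified at `p`» forces «at most one rational `p`-line»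
(`eq_of_isRationalLine_of_forall_not_lineUnramifiedAt`, the good-reduction twin of Cell C's lemma at a
multiplicative `p`). §3 `eq_of_stable_of_index_two`: for `H ≤ Γ_ℚ` of index `2` containing `I_{𝔓₀}`,
at most ONE `H`-stable line (an `H`-line `≠ L` is `I_{𝔓₀}`-fixed; two such generate `E[p]` and freeze
the mover; the remaining one is `g`-translated to itself for `g ∉ H`, hence rational, hence unramified —
excluded; the index-two descent was suggested on the cell bus by width seat `-w6` gen 23, whose scalar
case the mover kills outright). §4 `eq_of_stable_baseChange`: transfer to `E[p](K̄)`, `K` imaginary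
quadratic with `p` split, along the `Γ_K`-equivariant `RatClosure.pointsEquiv` with `H = res(Γ_K)`
(index `2`; `I_𝔓 ≤ H` for `𝔓 ∣ p`). §5 `residualPair_unique{,_of_anom}`: with the Literature reading
lemma `KellerYin2024.IsResidualPairOver.eq_of_unique_line_of_charZero` (p739410), ANY two residual pairs
`IsResidualPairOver (W.baseChange K) p θsub θquot` coincide under the crux's hypotheses (`2 < p`,
`Red W p`, `Anom W p`, (hlat), `K` imaginary quadratic, `p` split): the binders `∀ θsub θquot,
IsResidualPairOver … →` of `KellerYin2024.thm222_anacong_goodLattice_{of_ne_one,of_five_le,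
of_fullDescentDatum,OPEN}` range, inside the crux, over ONE pair (content-stub binder audit, evidence
#46, θ-axis now hypothesis-free). HONEST FRAMING: helper lemmas on the tree's own objects; 0 stubs /
cells / labels / tiers move; by-name surface of crux 2 unchanged (6); no summit statement, no case of
BSD, no crux or stub is proved here. References: [GreenbergVatsal2000] §2 p. 26, p. 28; [KellerYin2024]
§1.4 (arXiv:2402.12781v2 TeX L1063–1086); [Serre1972] §2.3 p. 280; [NeukirchANT1999] Ch. I §9.
-/

noncomputable section

open scoped Classical Pointwise

open NumberField IsDedekindDomain Field WeierstrassCurve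
open Literature.NumberTheory.EllipticCurves Literature.NumberTheory.GaloisRepresentations
open Literature.NumberTheory.EllipticCurves.Rank1Residual
open Literature.NumberTheory.EllipticCurves.KellerYin2024
open Literature.NumberTheory.EllipticCurves.RibetGoodLattice
open Literature.NumberTheory.EllipticCurves.RibetGoodLattice.IsogenyLineTypeGoodOrdinary

-- `Summit.BirchSwinnertonDyer.BirchSwinnertonDyer.…`: the summit and its single sub-problem share a name (D-0017 layout).
set_option linter.dupNamespace false

namespace Summit.BirchSwinnertonDyer.BirchSwinnertonDyer.Theorems.GoodLatticeStableLineUnique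

variable {p : ℕ} [hp : Fact p.Prime]

/-! ## §1 Two distinct lines generate `E[p]` (the companion `smul_eq_of_ne_line` is Cell C's, imported) -/

/-- Two distinct subgroups of prime order `p` of a group of order `p²` generate it. [folklore] -/
theorem sup_eq_top_of_ne {T : Type*} [AddCommGroup T] (hT : Nat.card T = p ^ 2)
    {Ψ₁ Ψ₂ : AddSubgroup T} (h₁ : Nat.card Ψ₁ = p) (h₂ : Nat.card Ψ₂ = p) (hne : Ψ₁ ≠ Ψ₂) :
    Ψ₁ ⊔ Ψ₂ = ⊤ := by
  have hpp : p.Prime := hp.out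
  haveI : Finite T := Nat.finite_of_card_ne_zero (by rw [hT]; exact pow_ne_zero 2 hpp.ne_zero)
  -- `|Ψ₁ ⊔ Ψ₂|` divides `p²` and is a proper multiple of `p`
  have hdvd : Nat.card ↥(Ψ₁ ⊔ Ψ₂) ∣ p ^ 2 := hT ▸ AddSubgroup.card_addSubgroup_dvd_card _
  obtain ⟨k, hk, hcard⟩ := (Nat.dvd_prime_pow hpp).mp hdvd
  have hle₁ : Ψ₁ ≤ Ψ₁ ⊔ Ψ₂ := le_sup_left
  have hp_dvd : p ∣ Nat.card ↥(Ψ₁ ⊔ Ψ₂) := h₁ ▸ AddSubgroup.card_dvd_of_le hle₁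
  have hk0 : k ≠ 0 := by
    rintro rfl
    rw [hcard, pow_zero, Nat.dvd_one] at hp_dvd
    exact hpp.one_lt.ne' hp_dvd
  have hk1 : k ≠ 1 := by
    rintro rfl
    rw [pow_one] at hcard
    -- then `Ψ₁ = Ψ₁ ⊔ Ψ₂ = Ψ₂`
    have e₁ : Ψ₁ = Ψ₁ ⊔ Ψ₂ := AddSubgroup.eq_of_le_of_card_ge hle₁ (by rw [hcard, h₁])
    have e₂ : Ψ₂ = Ψ₁ ⊔ Ψ₂ := AddSubgroup.eq_of_le_of_card_ge le_sup_right (by rw [hcard, h₂])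
    exact hne (e₁.trans e₂.symm)
  have hk2 : k = 2 := by omega
  subst hk2
  exact AddSubgroup.eq_top_of_card_eq _ (by rw [hcard, hT])

/-! ## §2 The reduction line at an odd good ordinary prime and the lines it does not meet -/

section OverQbar

variable (W : WeierstrassCurve ℚ) [W.IsElliptic] [W.IsGloballyMinimal]

omit [W.IsElliptic] [W.IsGloballyMinimal] in
/-- **A rational line other than the reduction line is unramified at `p`**: with `L` the reduction
line at `𝔓₀ ∣ p` (`(σ - 1)E[p] ⊆ L` on `I_{𝔓₀}`), a rational line `Φ ≠ L` is `I_{𝔓₀}`-fixed (§1), hence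
fixed by every `I_𝔓 = g I_{𝔓₀} g⁻¹` (transitivity on the primes above `p`, conjugation of inertia).
[cite: GreenbergVatsal2000, §2 p. 26] [cite: NeukirchANT1999, Ch. I §9 (9.1), (9.4)] -/
theorem lineUnramifiedAt_of_ne_reductionLine {v₀ : HeightOneSpectrum (𝓞 ℚ)}
    (hv₀ : (p : 𝓞 ℚ) ∈ v₀.asIdeal) {𝔓₀ : Ideal (absIntegers (𝓞 ℚ) ℚ)} (h𝔓₀ : 𝔓₀ ∈ v₀.primesAbove)
    {L : AddSubgroup (geomTorsion W (p : ℤ))} (hLcard : Nat.card L = p)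
    (hLtriv : ∀ σ ∈ 𝔓₀.inertia (absoluteGaloisGroup ℚ), ∀ P : geomTorsion W (p : ℤ), σ • P - P ∈ L)
    {Φ : AddSubgroup (geomTorsion W (p : ℤ))} (hΦ : IsRationalLine W p Φ) (hne : Φ ≠ L) :
    LineUnramifiedAt W p Φ := by
  intro v hv 𝔓 h𝔓 σ hσ P hP
  have hvv : v₀ = v := heightOneSpectrum_eq_of_natCast_mem hp.out hv₀ hv
  subst hvv
  obtain ⟨g, hg⟩ := HeightOneSpectrum.exists_smul_eq_of_mem_primesAbove_holds h𝔓₀ h𝔓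
  -- `g⁻¹ σ g ∈ I_{𝔓₀}` fixes `Φ` pointwise, in particular `g⁻¹ • P`
  have hτ : g⁻¹ * σ * g ∈ 𝔓₀.inertia (absoluteGaloisGroup ℚ) := by
    rw [← Ideal.conj_mem_inertia_smul_iff 𝔓₀ g, hg]
    have e : g * (g⁻¹ * σ * g) * g⁻¹ = σ := by group
    rwa [e]
  have hfix := SplitMultWallHlat.smul_eq_of_ne_line (p := p) hLcard hΦ.1 hne (fun Q hQ ↦ hΦ.2 _ Q hQ) (hLtriv _ hτ)
    (g⁻¹ • P) (hΦ.2 g⁻¹ P hP)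
  rw [mul_smul, mul_smul, smul_inv_smul] at hfix
  exact (MulAction.injective g⁻¹) hfix

/-- **At an odd GOOD ORDINARY prime, «every rational `p`-line ramified at `p`» ⟹ «at most one
rational `p`-line»** (good-reduction twin of `SplitMultWallHlat.eq_of_isRationalLine_of_forall_not_lineUnramifiedAt`):
of two distinct rational lines one differs from the reduction line, hence is unramified (§2). Input: the
tree's `exists_reductionLine_adicCompletionPrime`; no named fact. [cite: GreenbergVatsal2000, §2 p. 26 and p. 28] -/
theorem eq_of_isRationalLine_of_forall_not_lineUnramifiedAt (hp2 : p ≠ 2)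
    (hgood : W.HasGoodReductionAtPrime p) (hord : ¬ (p : ℤ) ∣ W.frobeniusTrace p)
    (hlat : ∀ Φ : AddSubgroup (geomTorsion W (p : ℤ)), IsRationalLine W p Φ → ¬ LineUnramifiedAt W p Φ)
    {Φ Φ' : AddSubgroup (geomTorsion W (p : ℤ))} (hΦ : IsRationalLine W p Φ)
    (hΦ' : IsRationalLine W p Φ') : Φ = Φ' := by
  by_contra hne
  obtain ⟨v₀, hv₀, 𝔓₀, h𝔓₀, L, hLcard, hLtriv, -⟩ :=
    exists_reductionLine_adicCompletionPrime W p hp2 hgood hord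
  by_cases hΦL : Φ = L
  · exact hlat Φ' hΦ' (lineUnramifiedAt_of_ne_reductionLine W hv₀ h𝔓₀ hLcard hLtriv hΦ'
      (fun h ↦ hne (hΦL.trans h.symm)))
  · exact hlat Φ hΦ (lineUnramifiedAt_of_ne_reductionLine W hv₀ h𝔓₀ hLcard hLtriv hΦ hΦL)

/-! ## §3 Lines stable under a normal subgroup of index two containing an inertia group at `p` -/

/-- **At most one `H`-stable line** (`H ≤ Γ_ℚ` of index `2` containing `I_{𝔓₀}` for one `𝔓₀ ∣ p`;
`W/ℚ` globally minimal, `p` odd good ordinary, (hlat), a rational line exists): an `H`-line `≠ L`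
(the reduction line) is `I_{𝔓₀}`-fixed (§1); two distinct such lines generate `E[p]` and freeze the
mover `σ₀`; the remaining candidate `Ψ` has `g • Ψ` (`g ∉ H`) `H`-stable and `≠ L = Φ`, so
`g • Ψ = Ψ` and `Ψ` is `Γ_ℚ = H ∪ gH`-stable: rational, `≠ L`, unramified (§2) — excluded.
[cite: GreenbergVatsal2000, §2 p. 26] [cite: Serre1972, §2.3 p. 280 (Borel subgroups: stable lines)] -/
theorem eq_of_stable_of_index_two (hp2 : p ≠ 2)
    (hgood : W.HasGoodReductionAtPrime p) (hord : ¬ (p : ℤ) ∣ W.frobeniusTrace p)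
    (hlat : ∀ Φ : AddSubgroup (geomTorsion W (p : ℤ)), IsRationalLine W p Φ → ¬ LineUnramifiedAt W p Φ)
    (hex : ∃ Φ : AddSubgroup (geomTorsion W (p : ℤ)), IsRationalLine W p Φ)
    {H : Subgroup (absoluteGaloisGroup ℚ)} (hH : H.index = 2)
    (hI : ∀ (v : HeightOneSpectrum (𝓞 ℚ)), (p : 𝓞 ℚ) ∈ v.asIdeal →
      ∀ 𝔓 ∈ v.primesAbove, 𝔓.inertia (absoluteGaloisGroup ℚ) ≤ H)
    {Ψ₁ Ψ₂ : AddSubgroup (geomTorsion W (p : ℤ))} (h₁ : Nat.card Ψ₁ = p)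
    (hs₁ : ∀ σ ∈ H, ∀ P ∈ Ψ₁, σ • P ∈ Ψ₁) (h₂ : Nat.card Ψ₂ = p)
    (hs₂ : ∀ σ ∈ H, ∀ P ∈ Ψ₂, σ • P ∈ Ψ₂) : Ψ₁ = Ψ₂ := by
  have hpp : p.Prime := hp.out
  by_contra hne
  obtain ⟨v₀, hv₀, 𝔓₀, h𝔓₀, L, hLcard, hLtriv, σ₀, hσ₀, P₀, hP₀, hmove⟩ :=
    exists_reductionLine_adicCompletionPrime W p hp2 hgood hord
  have hIH : 𝔓₀.inertia (absoluteGaloisGroup ℚ) ≤ H := hI v₀ hv₀ 𝔓₀ h𝔓₀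
  haveI : H.Normal := Subgroup.normal_of_index_eq_two hH
  -- `#E[p] = p²`
  have hT : Nat.card (geomTorsion W (p : ℤ)) = p ^ 2 := by
    haveI : CharZero (AlgebraicClosure ℚ) :=
      charZero_of_injective_algebraMap (algebraMap ℚ (AlgebraicClosure ℚ)).injective
    exact card_torsionPoints_eq_sq_holds W (AlgebraicClosure ℚ) (Nat.cast_ne_zero.mpr hpp.ne_zero)
  -- the rational line is the reduction line
  obtain ⟨Φ, hΦ⟩ := hex
  have hΦL : Φ = L := by
    by_contra h
    exact hlat Φ hΦ (lineUnramifiedAt_of_ne_reductionLine W hv₀ h𝔓₀ hLcard hLtriv hΦ h)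
  -- an `H`-stable line other than `L` is fixed pointwise by `I_{𝔓₀}`
  have hfix : ∀ {Ψ : AddSubgroup (geomTorsion W (p : ℤ))}, Nat.card Ψ = p →
      (∀ σ ∈ H, ∀ P ∈ Ψ, σ • P ∈ Ψ) → Ψ ≠ L →
      ∀ σ ∈ 𝔓₀.inertia (absoluteGaloisGroup ℚ), ∀ P ∈ Ψ, σ • P = P :=
    fun hΨ hsΨ hΨL σ hσ ↦ SplitMultWallHlat.smul_eq_of_ne_line (p := p) hLcard hΨ hΨL (hsΨ σ (hIH hσ)) (hLtriv σ hσ)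
  -- two distinct such lines cannot coexist: they generate `E[p]`, on which `σ₀` would be trivial
  have hatMostOne : ∀ {Ψ Ψ' : AddSubgroup (geomTorsion W (p : ℤ))}, Nat.card Ψ = p →
      (∀ σ ∈ H, ∀ P ∈ Ψ, σ • P ∈ Ψ) → Ψ ≠ L → Nat.card Ψ' = p →
      (∀ σ ∈ H, ∀ P ∈ Ψ', σ • P ∈ Ψ') → Ψ' ≠ L → Ψ = Ψ' := by
    intro Ψ Ψ' hΨ hsΨ hΨL hΨ' hsΨ' hΨ'L
    by_contra hΨΨ'
    have hsup : Ψ ⊔ Ψ' = ⊤ := sup_eq_top_of_ne (p := p) hT hΨ hΨ' hΨΨ'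
    -- `σ₀` fixes `Ψ ⊔ Ψ' = E[p]` pointwise
    have hall : ∀ P : geomTorsion W (p : ℤ), σ₀ • P = P := by
      intro P
      have hPmem : P ∈ Ψ ⊔ Ψ' := by rw [hsup]; exact AddSubgroup.mem_top P
      obtain ⟨Q, hQ, R, hR, rfl⟩ := AddSubgroup.mem_sup.mp hPmem
      rw [smul_add, hfix hΨ hsΨ hΨL σ₀ hσ₀ Q hQ, hfix hΨ' hsΨ' hΨ'L σ₀ hσ₀ R hR]
    exact hmove (hall P₀)
  -- one of `Ψ₁, Ψ₂` differs from `L`; call it `Ψ`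
  obtain ⟨Ψ, hΨ, hsΨ, hΨL⟩ : ∃ Ψ : AddSubgroup (geomTorsion W (p : ℤ)), Nat.card Ψ = p ∧
      (∀ σ ∈ H, ∀ P ∈ Ψ, σ • P ∈ Ψ) ∧ Ψ ≠ L := by
    by_cases h : Ψ₁ = L
    · exact ⟨Ψ₂, h₂, hs₂, fun h' ↦ hne (h.trans h'.symm)⟩
    · exact ⟨Ψ₁, h₁, hs₁, h⟩
  -- an element `g ∉ H`; the translate `g • Ψ` is `H`-stable of order `p`
  obtain ⟨g, hgH⟩ : ∃ g : absoluteGaloisGroup ℚ, g ∉ H := by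
    by_contra hall
    push Not at hall
    have : H = ⊤ := eq_top_iff.mpr fun x _ ↦ hall x
    rw [this, Subgroup.index_top] at hH
    exact absurd hH (by norm_num)
  let gΨ : AddSubgroup (geomTorsion W (p : ℤ)) := Ψ.map (DistribMulAction.toAddMonoidEnd _ _ g)
  have hgΨmem : ∀ Q, Q ∈ gΨ ↔ ∃ P ∈ Ψ, g • P = Q := fun Q ↦ by
    rw [AddSubgroup.mem_map]
    rfl
  have hgΨcard : Nat.card gΨ = p :=
    (Nat.card_congr (Ψ.equivMapOfInjective (DistribMulAction.toAddMonoidEnd _ _ g)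
      (fun a b h ↦ MulAction.injective g h)).toEquiv).symm.trans hΨ
  have hgΨstab : ∀ σ ∈ H, ∀ Q ∈ gΨ, σ • Q ∈ gΨ := by
    intro σ hσ Q hQ
    obtain ⟨P, hP, rfl⟩ := (hgΨmem Q).mp hQ
    refine (hgΨmem _).mpr ⟨(g⁻¹ * σ * g) • P, hsΨ _ ?_ P hP, ?_⟩
    · have := ‹H.Normal›.conj_mem σ hσ g⁻¹
      rwa [inv_inv] at this
    · rw [← mul_smul, ← mul_assoc, ← mul_assoc, mul_inv_cancel, one_mul, mul_smul]
  -- `g • Ψ ≠ L` because `L = Φ` is `Γ_ℚ`-stable and `Ψ ≠ L`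
  have hΦstab : ∀ (τ : absoluteGaloisGroup ℚ) (P : geomTorsion W (p : ℤ)), P ∈ L → τ • P ∈ L := by
    intro τ P hP; rw [← hΦL] at hP ⊢; exact hΦ.2 τ P hP
  have hgΨL : gΨ ≠ L := by
    intro h
    apply hΨL
    -- `Ψ ≤ L` (apply `g⁻¹` to `g • Ψ = L`), and both have order `p`
    haveI : Finite L := Nat.finite_of_card_ne_zero (by rw [hLcard]; exact hpp.ne_zero)
    refine AddSubgroup.eq_of_le_of_card_ge (fun P hP ↦ ?_) (by rw [hLcard, hΨ])
    have hgP : g • P ∈ L := by rw [← h]; exact (hgΨmem _).mpr ⟨P, hP, rfl⟩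
    have := hΦstab g⁻¹ _ hgP
    rwa [inv_smul_smul] at this
  -- hence `g • Ψ = Ψ` (at most one `H`-line off `L`)
  have hgΨeq : gΨ = Ψ := hatMostOne hgΨcard hgΨstab hgΨL hΨ hsΨ hΨL
  -- so `Ψ` is `Γ_ℚ`-stable: every `τ` is in `H` or in `gH`... precisely `τ ∈ H` or `τ * g⁻¹ ∈ H`
  have hΨrat : IsRationalLine W p Ψ := by
    refine ⟨hΨ, fun τ P hP ↦ ?_⟩
    by_cases hτ : τ ∈ H
    · exact hsΨ τ hτ P hP
    · have hτg : τ * g⁻¹ ∈ H := by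
        rcases (Subgroup.mul_mem_iff_of_index_two hH (a := τ) (b := g⁻¹)) with hiff
        exact hiff.mpr ⟨fun h ↦ absurd h hτ, fun h ↦ absurd h (fun h' ↦ hgH (by simpa using H.inv_mem h'))⟩
      have e : τ • P = (τ * g⁻¹) • (g • P) := by rw [← mul_smul, inv_mul_cancel_right]
      rw [e]
      refine hsΨ _ hτg _ ?_
      rw [← hgΨeq]
      exact (hgΨmem _).mpr ⟨P, hP, rfl⟩
  -- a rational line `≠ L` is unramified at `p`: contradiction with the normalisation
  exact hlat Ψ hΨrat (lineUnramifiedAt_of_ne_reductionLine W hv₀ h𝔓₀ hLcard hLtriv hΨrat hΨL)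

end OverQbar

/-! ## §4 Transfer to `E[p](K̄)` for an imaginary quadratic `K` with `p` split -/

section OverK

variable (W : WeierstrassCurve ℚ) [W.IsElliptic] [W.IsGloballyMinimal]
  (K : Type) [Field K] [NumberField K]

/-- **At most one `Γ_K`-stable line in `E[p](K̄)`** for the good lattice (`p` odd good ordinary,
(hlat), `E[p]` reducible) and `K` imaginary quadratic with `p` split: §3 transported along the
`Γ_K`-equivariant `RatClosure.pointsEquiv : E(ℚ̄) ≃ E(K̄)` with `H = res(Γ_K)` (index `2`,
`isOpen_range_absGaloisRestrict_and_index_eq_two`; `I_𝔓 ≤ H` for `𝔓 ∣ p`,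
`inertia_le_range_absGaloisRestrict_of_split`). [cite: KellerYin2024, §1.4 (arXiv:2402.12781v2 TeX L1077–1086)]
[cite: GreenbergVatsal2000, §2 p. 26] [cite: NeukirchANT1999, Ch. I §9 (9.6)] -/
theorem eq_of_stable_baseChange (hp2 : p ≠ 2)
    (hgood : W.HasGoodReductionAtPrime p) (hord : ¬ (p : ℤ) ∣ W.frobeniusTrace p)
    (hlat : ∀ Φ : AddSubgroup (geomTorsion W (p : ℤ)), IsRationalLine W p Φ → ¬ LineUnramifiedAt W p Φ)
    (hred : Red W p) (hK : IsImaginaryQuadratic K) (hHp : SatisfiesHeegnerHypothesis p K)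
    {Ψ₁ Ψ₂ : AddSubgroup (geomPoints (W.baseChange K))}
    (h₁ : Nat.card Ψ₁ = p) (hle₁ : Ψ₁ ≤ geomTorsion (W.baseChange K) (p : ℤ))
    (hs₁ : ∀ σ : absoluteGaloisGroup K, ∀ P ∈ Ψ₁, σ • P ∈ Ψ₁)
    (h₂ : Nat.card Ψ₂ = p) (hle₂ : Ψ₂ ≤ geomTorsion (W.baseChange K) (p : ℤ))
    (hs₂ : ∀ σ : absoluteGaloisGroup K, ∀ P ∈ Ψ₂, σ • P ∈ Ψ₂) : Ψ₁ = Ψ₂ := by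
  let e : geomPoints W ≃+ geomPoints (W.baseChange K) := RatClosure.pointsEquiv (K := K) W
  -- pull back to `E[p](ℚ̄)`
  let pull : AddSubgroup (geomPoints (W.baseChange K)) → AddSubgroup (geomTorsion W (p : ℤ)) :=
    fun Ψ ↦ (Ψ.comap e.toAddMonoidHom).comap (geomTorsion W (p : ℤ)).subtype
  have hmem : ∀ (Ψ : AddSubgroup (geomPoints (W.baseChange K))) (P : geomTorsion W (p : ℤ)),
      P ∈ pull Ψ ↔ e (P : geomPoints W) ∈ Ψ := fun Ψ P ↦ Iff.rfl
  -- torsion is preserved by `e`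
  have htor : ∀ Q : geomPoints (W.baseChange K), Q ∈ geomTorsion (W.baseChange K) (p : ℤ) →
      e.symm Q ∈ geomTorsion W (p : ℤ) := fun Q hQ ↦ by
    rw [mem_geomTorsion_iff] at hQ ⊢
    apply e.injective
    rw [map_zsmul, AddEquiv.apply_symm_apply, hQ, map_zero]
  -- the pull-back has the same order
  have hcard : ∀ (Ψ : AddSubgroup (geomPoints (W.baseChange K))),
      Ψ ≤ geomTorsion (W.baseChange K) (p : ℤ) → Nat.card (pull Ψ) = Nat.card Ψ := fun Ψ hle ↦ by
    refine Nat.card_congr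
      { toFun := fun P ↦ ⟨e ((P : geomTorsion W (p : ℤ)) : geomPoints W), (hmem Ψ _).mp P.2⟩
        invFun := fun Q ↦ ⟨⟨e.symm (Q : geomPoints (W.baseChange K)), htor _ (hle Q.2)⟩,
          (hmem Ψ _).mpr (by rw [AddEquiv.apply_symm_apply]; exact Q.2)⟩
        left_inv := fun P ↦ by ext; simp
        right_inv := fun Q ↦ by ext; simp }
  -- and is stable under `H = res(Γ_K)`
  have hstab : ∀ (Ψ : AddSubgroup (geomPoints (W.baseChange K))),
      (∀ σ : absoluteGaloisGroup K, ∀ P ∈ Ψ, σ • P ∈ Ψ) →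
      ∀ σ ∈ (absGaloisRestrict ℚ K).range, ∀ P ∈ pull Ψ, σ • P ∈ pull Ψ := by
    rintro Ψ hΨ _ ⟨g, rfl⟩ P hP
    rw [hmem] at hP ⊢
    rw [AddSubgroup.torsionBy.coe_smul]
    change e (absGaloisRestrict ℚ K g • (P : geomPoints W)) ∈ Ψ
    rw [RatClosure.pointsEquiv_smul]
    exact hΨ g _ hP
  -- §3 applies to the pull-backs
  have hH := (Literature.NumberTheory.Automorphic.isOpen_range_absGaloisRestrict_and_index_eq_two ℚ K hK.1).2
  have hI : ∀ (v : HeightOneSpectrum (𝓞 ℚ)), (p : 𝓞 ℚ) ∈ v.asIdeal →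
      ∀ 𝔓 ∈ v.primesAbove, 𝔓.inertia (absoluteGaloisGroup ℚ) ≤ (absGaloisRestrict ℚ K).range :=
    fun v hv 𝔓 h𝔓 ↦
      Summit.BirchSwinnertonDyer.Rank1Residual.X1.KellerYinGoodLattice.inertia_le_range_absGaloisRestrict_of_split
        hK hHp hv h𝔓
  have hex : ∃ Φ : AddSubgroup (geomTorsion W (p : ℤ)), IsRationalLine W p Φ :=
    exists_isRationalLine_of_not_irr (W := W) (p := p) hred
  have heq : pull Ψ₁ = pull Ψ₂ :=
    eq_of_stable_of_index_two W hp2 hgood hord hlat hex hH hI ((hcard Ψ₁ hle₁).trans h₁)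
      (hstab Ψ₁ hs₁) ((hcard Ψ₂ hle₂).trans h₂) (hstab Ψ₂ hs₂)
  -- push forward again
  ext Q
  constructor
  · intro hQ
    have hQt := htor Q (hle₁ hQ)
    have h1 : (⟨e.symm Q, hQt⟩ : geomTorsion W (p : ℤ)) ∈ pull Ψ₁ :=
      (hmem Ψ₁ _).mpr (by rw [AddEquiv.apply_symm_apply]; exact hQ)
    rw [heq, hmem, AddEquiv.apply_symm_apply] at h1
    exact h1
  · intro hQ
    have hQt := htor Q (hle₂ hQ)
    have h1 : (⟨e.symm Q, hQt⟩ : geomTorsion W (p : ℤ)) ∈ pull Ψ₂ :=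
      (hmem Ψ₂ _).mpr (by rw [AddEquiv.apply_symm_apply]; exact hQ)
    rw [← heq, hmem, AddEquiv.apply_symm_apply] at h1
    exact h1

/-! ## §5 The residual pair over `K` is unique (θ-axis of the crux-2 content stub, hypothesis-free) -/

/-- **Uniqueness of the residual pair `(θsub, θquot)` of the good lattice over `K`**: for `W/ℚ`
globally minimal, `p` odd good ORDINARY, `E[p]` reducible with every rational `p`-line ramified at `p`,
`K` imaginary quadratic with `p` split, any two residual pairs `IsResidualPairOver (W.baseChange K) p`
coincide (§4 + `IsResidualPairOver.eq_of_unique_line_of_charZero`). So the `∀ θsub θquot,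
IsResidualPairOver … →` binders of `thm222_anacong_goodLattice_{of_ne_one,of_five_le,of_fullDescentDatum,OPEN}`
range, inside crux 2, over ONE pair (the restriction of `exists_teichmullerPair`'s pair).
[cite: KellerYin2024, §1.4 display (char to f) (arXiv:2402.12781v2 TeX L1066–1086)]
[cite: CastellaGrossiLeeSkinner2022, Thm. 2.2.2 (hypothesis "`E[p]^{ss} = 𝔽_p(φ) ⊕ 𝔽_p(ψ)`")] -/
theorem residualPair_unique (hp2 : p ≠ 2)
    (hgood : W.HasGoodReductionAtPrime p) (hord : ¬ (p : ℤ) ∣ W.frobeniusTrace p)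
    (hlat : ∀ Φ : AddSubgroup (geomTorsion W (p : ℤ)), IsRationalLine W p Φ → ¬ LineUnramifiedAt W p Φ)
    (hred : Red W p) (hK : IsImaginaryQuadratic K) (hHp : SatisfiesHeegnerHypothesis p K)
    {S : Set (PadicAlgCl p)}
    {θsub θquot θsub' θquot' : FramedGaloisRep K (padicCoeffIntegers S) 1}
    (h : IsResidualPairOver (W.baseChange K) p θsub θquot)
    (h' : IsResidualPairOver (W.baseChange K) p θsub' θquot') :
    θsub = θsub' ∧ θquot = θquot' := by
  haveI : (W.baseChange K).IsElliptic := inferInstance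
  exact h.eq_of_unique_line_of_charZero h' fun Φ Φ' hΦ hle hst hΦ' hle' hst' ↦
    eq_of_stable_baseChange W K hp2 hgood hord hlat hred hK hHp hΦ hle hst hΦ' hle' hst'

/-- **The same, in the crux's vocabulary** (`2 < p`, `Red W p`, `Anom W p` — which carries good
reduction and `p ∣ a_p − 1`, hence ordinarity `p ∤ a_p` —, the normalisation, `K` imaginary
quadratic with `SatisfiesHeegnerHypothesis p K`): the residual pair over `K` is unique.
[cite: KellerYin2024, §1.4 display (char to f) (arXiv:2402.12781v2 TeX L1066–1086)] -/
theorem residualPair_unique_of_anom (hp : 2 < p) (hred : Red W p) (hanom : Anom W p)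
    (hlat : ∀ Φ : AddSubgroup (geomTorsion W (p : ℤ)), IsRationalLine W p Φ → ¬ LineUnramifiedAt W p Φ)
    (hK : IsImaginaryQuadratic K) (hHp : SatisfiesHeegnerHypothesis p K)
    {S : Set (PadicAlgCl p)}
    {θsub θquot θsub' θquot' : FramedGaloisRep K (padicCoeffIntegers S) 1}
    (h : IsResidualPairOver (W.baseChange K) p θsub θquot)
    (h' : IsResidualPairOver (W.baseChange K) p θsub' θquot') :
    θsub = θsub' ∧ θquot = θquot' := by
  refine residualPair_unique W K hp.ne' hanom.2.1 (fun hdvd ↦ ?_) hlat hred hK hHp h h'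
  -- `p ∣ a_p` and `p ∣ a_p - 1` give `p ∣ 1`
  have h1 : (p : ℤ) ∣ 1 := by
    have := dvd_sub hdvd hanom.2.2
    rwa [sub_sub_cancel] at this
  have hp1 : (p : ℤ) ≤ 1 := Int.le_of_dvd one_pos h1
  have : (2 : ℤ) < p := by exact_mod_cast hp
  omega

end OverK

end Summit.BirchSwinnertonDyer.BirchSwinnertonDyer.Theorems.GoodLatticeStableLineUnique
end
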